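import Mathlib.Topology.Algebra.Group.SubmonoidClosure
import Literature.LinearAlgebra.Matrix.SimultaneousConjugacyProducts
import HarnessLib

/-!
# Simultaneous conjugacy in COMPACT groups: positive products suffice, and finite families suffice
# ([Sengupta1994] Thm 2's hypothesis vs. [Levy2004] Prop. 3.4's; [Levy2004] Prop. 3.5's compactness step)

statement-level skeleton of published theorems with citation tags; proofs where landed; nothing here is a claim about
the Yang–Mills mass gap

Cell `lit-balaban`, unit p24 gen 22, file E of the own-lane free target (G.5-34(d); no SKELETON row); a topological
supplement to `SimultaneousConjugacyProducts` (`ProdConjDetermined G`: conjugacy of all non-empty POSITIVE products of two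
families forces simultaneous conjugacy — [Sengupta1994] Thm 2's form) used by the lattice criterion of
`Balaban1983to89/ClassLoopObservablesDenseIff` ([Levy2004] Prop. 3.4's form: conjugacy of all WORDS, letters and their
inverses, of two FINITE families).  For a compact Hausdorff group the two hypotheses and the two ranges of families
agree:

* §1 **`isConj_of_mem_subgroupClosure`: if every non-empty positive product of the `V i` is conjugate to the same
  product of the `W i`, then EVERY element of the subgroup of `G × G` generated by the pairs `(V i, W i)` — i.e. every
  word in the letters and their inverses, evaluated at `V` and at `W` — has conjugate components.**  Mathlib's
  `closure_submonoidClosure_eq_closure_subgroupClosure` (in a compact group the submonoid and the subgroup generated by a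
  set have the same closure: `x⁻¹` is a limit of positive powers of `x`) and the closedness of the conjugacy relation
  in a compact Hausdorff group (`isClosed_setOf_isConj`).  [Sengupta1994] p.900 uses the positive products only («It is
  only this apparently weaker hypothesis that will be used»); [Levy2004] Prop. 3.4 is stated with «all word w in r
  letters and their inverses»;
* §2 **`prodConjDetermined_of_finite`: if finite families with conjugate positive products are simultaneously
  conjugate, so are arbitrary families** — [Levy2004]'s compactness step in the proof of Prop. 3.5 p.5 («For any finite
  family F of loops based at v, let K_F be the closed subset of G consisting of those k such that h_l(g′) = k h_l(g) k⁻¹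
  for all l ∈ F. By assumption, K_F is non-empty, just as any finite intersection of sets of the form K_F. By compactness
  of G, there exists k such that h_l(g′) = k h_l(g) k⁻¹ for every loop l based at v.»), via
  `IsCompact.elim_finite_subfamily_closed`.

HONEST SCOPE.  Compact Hausdorff topological groups only (both statements fail without compactness: in `ℤ` the
positive multiples of `1` and `−1`… are never equal, and in non-compact groups finite-subfamily conjugators need not
converge).  Pure group topology; NOT summit progress.

## References

* [Sengupta1994] A. Sengupta, *Gauge invariant functions of connections*, Proc. AMS 121 (1994) 897–905, Thm 2 and its
  proof p.900.
* [Levy2004] T. Lévy, J. Geom. Phys. 52 (2004) 382–397 (arXiv:math-ph/0306059 pagination), Props 3.4, 3.5 p.5.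
-/

namespace Literature.LinearAlgebra.Matrix.SimultaneousConjugacyCompact

open Literature.LinearAlgebra.Matrix (ProdConjDetermined)

universe u v

variable {G : Type u} [Group G] [TopologicalSpace G] [IsTopologicalGroup G] [CompactSpace G] [T2Space G]

/-! ## §1 Positive products suffice in a compact group -/

section PositiveWords

/-- **In a compact Hausdorff group the conjugacy relation is closed**: `{(a, b) | b = c a c⁻¹ for some c}` is the image
of the compact `G × G` under `(a, c) ↦ (a, c a c⁻¹)`. [cite: Levy2004, Prop 3.5 p.5 (proof: «the closed subset … of those k such that h_l(g′) = k h_l(g) k⁻¹»)] -/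
theorem isClosed_setOf_isConj : IsClosed {p : G × G | IsConj p.1 p.2} := by
  have hset : {p : G × G | IsConj p.1 p.2} = Set.range fun q : G × G => (q.1, q.2 * q.1 * q.2⁻¹) := by
    ext p
    constructor
    · intro h
      obtain ⟨c, hc⟩ := isConj_iff.1 h
      exact ⟨(p.1, c), Prod.ext rfl hc⟩
    · rintro ⟨q, rfl⟩
      exact isConj_iff.2 ⟨q.2, rfl⟩
  rw [hset]
  exact (isCompact_range ((continuous_fst.prodMk
    ((continuous_snd.mul continuous_fst).mul continuous_snd.inv)))).isClosed

variable {ι : Type v}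

omit [TopologicalSpace G] [IsTopologicalGroup G] [CompactSpace G] [T2Space G] in
/-- The submonoid of `G × G` generated by the pairs `(V i, W i)` consists of the pairs of POSITIVE PRODUCTS
`(V_{i_1} ⋯ V_{i_k}, W_{i_1} ⋯ W_{i_k})`. [cite: Sengupta1994, Thm 2 p.900 (the products g_{a_1} ⋯ g_{a_k})] -/
theorem exists_list_of_mem_submonoidClosure {V W : ι → G} {x : G × G}
    (hx : x ∈ Submonoid.closure (Set.range fun i : ι => (V i, W i))) :
    ∃ l : List ι, x = ((l.map V).prod, (l.map W).prod) := by
  induction hx using Submonoid.closure_induction with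
  | mem x hx =>
    obtain ⟨i, rfl⟩ := hx
    exact ⟨[i], by simp⟩
  | one => exact ⟨[], by simp only [List.map_nil, List.prod_nil]; rfl⟩
  | mul x y _ _ hx hy =>
    obtain ⟨l₁, rfl⟩ := hx
    obtain ⟨l₂, rfl⟩ := hy
    exact ⟨l₁ ++ l₂, by simp [List.map_append, List.prod_append]⟩

/-- **POSITIVE PRODUCTS SUFFICE IN A COMPACT GROUP.**  If every non-empty positive product of the `V i` is conjugate to
the same product of the `W i` ([Sengupta1994] Thm 2's hypothesis), then every element of the subgroup of `G × G`
generated by the pairs `(V i, W i)` — every word in the letters AND THEIR INVERSES evaluated at `V` and at `W`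
([Levy2004] Prop. 3.4's hypothesis) — has conjugate components: the subgroup and the submonoid generated by the pairs
have the same closure (Mathlib `closure_submonoidClosure_eq_closure_subgroupClosure`: in a compact group `x⁻¹` is a
limit of positive powers of `x`), the submonoid consists of pairs of positive products, and the conjugacy relation is
closed. [cite: Sengupta1994, Thm 2 p.900 («It is only this apparently weaker hypothesis that will be used»); Levy2004, Prop 3.4 p.5] -/
theorem isConj_of_mem_subgroupClosure (V W : ι → G)
    (h : ∀ l : List ι, l ≠ [] → IsConj (l.map V).prod (l.map W).prod) {x : G × G}
    (hx : x ∈ Subgroup.closure (Set.range fun i : ι => (V i, W i))) : IsConj x.1 x.2 := by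
  have hsub : ((Submonoid.closure (Set.range fun i : ι => (V i, W i)) : Submonoid (G × G)) : Set (G × G)) ⊆
      {p : G × G | IsConj p.1 p.2} := by
    intro y hy
    obtain ⟨l, rfl⟩ := exists_list_of_mem_submonoidClosure hy
    rcases eq_or_ne l [] with rfl | hl
    · simp
    · exact h l hl
  have hcl : closure ((Subgroup.closure (Set.range fun i : ι => (V i, W i)) : Set (G × G))) ⊆
      {p : G × G | IsConj p.1 p.2} := by
    rw [← closure_submonoidClosure_eq_closure_subgroupClosure]
    exact closure_minimal hsub isClosed_setOf_isConj
  exact hcl (subset_closure hx)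

omit [TopologicalSpace G] [IsTopologicalGroup G] [CompactSpace G] [T2Space G] in
/-- The product of the pairs is the pair of the products. [cite: Sengupta1994, Thm 2 p.900 (the products g_{a_1} ⋯ g_{a_k})] -/
theorem prod_map_pair (V W : ι → G) :
    ∀ l : List ι, (l.map fun i => ((V i, W i) : G × G)).prod = ((l.map V).prod, (l.map W).prod)
  | [] => rfl
  | i :: l => by
    rw [List.map_cons, List.prod_cons, prod_map_pair V W l, List.map_cons, List.map_cons, List.prod_cons,
      List.prod_cons, Prod.mk_mul_mk]

/-- In particular (the two hypotheses AGREE for compact `G`): conjugacy of all non-empty positive products ⟺ conjugacy of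
all elements of the generated subgroup of pairs. [cite: Sengupta1994, Thm 2 p.900; Levy2004, Prop 3.4 p.5] -/
theorem forall_isConj_prod_iff_subgroupClosure (V W : ι → G) :
    (∀ l : List ι, l ≠ [] → IsConj (l.map V).prod (l.map W).prod) ↔
      ∀ x ∈ Subgroup.closure (Set.range fun i : ι => (V i, W i)), IsConj x.1 x.2 := by
  refine ⟨fun h x hx => isConj_of_mem_subgroupClosure V W h hx, fun h l _ => ?_⟩
  have hmem : ((l.map V).prod, (l.map W).prod) ∈ Subgroup.closure (Set.range fun i : ι => (V i, W i)) := by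
    rw [← prod_map_pair]
    exact list_prod_mem fun x hx => by
      obtain ⟨i, _, rfl⟩ := List.mem_map.1 hx
      exact Subgroup.subset_closure ⟨i, rfl⟩
  exact h _ hmem

end PositiveWords

/-! ## §2 Finite families suffice in a compact group -/

section FiniteFamilies

/-- **FINITE FAMILIES SUFFICE IN A COMPACT GROUP** ([Levy2004] Prop. 3.5's compactness step): if for every `r` any two
families `V, W : Fin r → G` whose non-empty positive products are conjugate are simultaneously conjugate, then
`ProdConjDetermined G` holds for families indexed by ARBITRARY types — the conjugators of the finite subfamilies form a
family of closed sets with the finite intersection property. [cite: Levy2004, Prop 3.5 p.5 («By compactness of G, there exists k such that h_l(g′) = k h_l(g) k⁻¹ for every loop l based at v»)] -/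
theorem prodConjDetermined_of_finite
    (hfin : ∀ (r : ℕ) (V W : Fin r → G),
      (∀ l : List (Fin r), l ≠ [] → ∃ y : G, (l.map W).prod = y * (l.map V).prod * y⁻¹) →
        ∃ y : G, ∀ i, W i = y * V i * y⁻¹) :
    ProdConjDetermined.{u, v} G := by
  intro ι V W h
  classical
  -- the closed sets of conjugators of the single letters
  let K : ι → Set G := fun i => {y | W i = y * V i * y⁻¹}
  have hK : ∀ i, IsClosed (K i) := fun i =>
    isClosed_eq continuous_const ((continuous_id.mul continuous_const).mul continuous_id.inv)
  by_contra hne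
  push Not at hne
  have hempty : Set.univ ∩ ⋂ i, K i = ∅ := by
    rw [Set.univ_inter, Set.eq_empty_iff_forall_notMem]
    intro y hy
    obtain ⟨i, hi⟩ := hne y
    exact hi (Set.mem_iInter.1 hy i)
  obtain ⟨u, hu⟩ := isCompact_univ.elim_finite_subfamily_closed K hK hempty
  -- the finite subfamily indexed by `u`, transported to `Fin u.card`
  let e := u.equivFin
  obtain ⟨y, hy⟩ := hfin u.card (fun k => V (e.symm k)) (fun k => W (e.symm k)) fun l hl => by
    obtain ⟨y, hy⟩ := h (l.map fun k => ((e.symm k : ↥u) : ι)) (by simpa using hl)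
    exact ⟨y, by simpa [List.map_map, Function.comp_def] using hy⟩
  have hyu : y ∈ Set.univ ∩ ⋂ i ∈ u, K i := by
    refine ⟨Set.mem_univ _, Set.mem_iInter₂.2 fun i hi => ?_⟩
    have := hy (e ⟨i, hi⟩)
    simp only [Equiv.symm_apply_apply] at this
    exact this
  rw [hu] at hyu
  exact hyu

/-- Conversely `ProdConjDetermined` restricts to finite families (trivially), so for compact `G` the property is
EQUIVALENT to its finite-family form. [cite: Levy2004, Prop 3.5 p.5] -/
theorem prodConjDetermined_iff_finite :
    ProdConjDetermined.{u, 0} G ↔ ∀ (r : ℕ) (V W : Fin r → G),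
      (∀ l : List (Fin r), l ≠ [] → ∃ y : G, (l.map W).prod = y * (l.map V).prod * y⁻¹) →
        ∃ y : G, ∀ i, W i = y * V i * y⁻¹ :=
  ⟨fun h _ V W hVW => h V W hVW, fun h => prodConjDetermined_of_finite h⟩

/-- The universe-`v` form from the finite-family form. [cite: Levy2004, Prop 3.5 p.5] -/
theorem prodConjDetermined_univ_of_zero (h : ProdConjDetermined.{u, 0} G) : ProdConjDetermined.{u, v} G :=
  prodConjDetermined_of_finite fun _ V W hVW => h V W hVW

end FiniteFamilies

end Literature.LinearAlgebra.Matrix.SimultaneousConjugacyCompact
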